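import Literature.MathematicalPhysics.QuantumFieldTheory.Balaban1983to89.BlockAveraging

/-!
# BalabanUVNodes ∕ N08 — WEIGHTED LAUNDERING ALONG THE AXIAL REFERENCE: a density that does not read the LAST bond of any straight segment is
# pushed by the straight transporter `AveragingRT.axialAvg` to an EXACT multiple of product Haar, `(f·dU_j)∘Ū_ax⁻¹ = (∫f)•dU_{j+1}`

Track A, DAG node N08 = [Balaban1985UV3] Thm 1 p. 257 ∕ Thm 2 p. 272 (the K-fold transported history masses (41) p. 266); the averaging = [Balaban1987RG1] (0.4) p. 253,
whose UNGUARDED branch (`corr = 1` off the small-field domain) IS the straight transporter `AveragingRT.axialAvg` (lit `BlockAveraging`, §3 of its header).  Cell `pub-ymgap`,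
seat `pub-ymgap-dag-n08-d` g47 on the R529-ym summon (hJ = I-09, the N08 loop part; LOCATE `N08-HJ-LOOPPART-LOCATE-g47.md` §4 (β3)): `--supports stmt-QuantumFields-19936`
(helper; N08 vocabulary keyed K1⁹ 27364 by the desk).  Companion of ✓`BalabanUVNodesN08KFoldTransportEnvelopeT3` (p754015).

THE POINT (the cross-level engine of the lopsided polymer bound (β)).  In the cluster expansion of the top-ending partial iterates `ι_{j,K}` of Haar under the guarded
block averaging, the reference dynamics is the axial branch; a «shape» (a non-negative density bump `f`) produced at level `j` by guard firings is carried to level `j+1`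
by `Ū_ax`.  If `f` does not read the LAST fine bond of any straight segment — e.g. `f` reads the four sides of ONE plaquette, or any bond set containing no full segment
after choosing the free end — then right-translating those last bonds by a coarse field `g` leaves `f·dU_j` invariant and right-translates `Ū_ax` by `g`
(`AveragingRT.axialAvg_mul_last`); so `(f·dU_j)∘Ū_ax⁻¹` is a finite RIGHT-invariant measure on the coarse fields, hence `(∫f)•dU_{j+1}` by Weil's uniqueness
(`AveragingRT.measure_eq_mass_smul_of_invariant`, the argument of `AveragingRT.map_axialAvg` with a weight): THE BUMP IS INVISIBLE ONE LEVEL UP — exactly, not approximately.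
Shapes therefore propagate upward only through guard firings at consecutive levels (activity `≤ K_α·hⁿ` each), which is what makes hTop's constant K-uniform.

WHAT THIS FILE PROVES ([folklore] measure theory on the tree's objects; nothing of the paper asserted):
* §1 `map_withDensity_eq_of_comp_eq` — a measure-preserving map fixing the density fixes the weighted measure.
* §2 ★★★ `map_withDensity_axialAvg_eq_smul` — `((dU_j).withDensity f).map axialAvg = (∫⁻ f dU_j) • dU_{j+1}` for measurable `f` of finite integral, invariant under
  right-translation of the last bonds (standing range `j + 1 ≤ m + K`); ★ `map_restrict_axialAvg_eq_smul` — the set form (`f = 1_A`, `A` invariant): `(dU_j↾A)∘Ū_ax⁻¹ = dU_j(A)•dU_{j+1}`.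
HONEST: count-neutral helper; hTop ∕ (a)′∀ ∕ hJ NOT proved; E6′ not decided; N08 NOT discharged; R3 ≠ d = 4 ∕ mass gap ∕ Clay.  0 `sorry`, 0 `def`.
-/

noncomputable section

open MeasureTheory
open scoped ENNReal

namespace Summit.QuantumFields.YangMills.Theorems.BalabanUVNodesN08AxialLaunderingWeighted

open Literature.MathematicalPhysics.QuantumFieldTheory.Balaban1983to89
open Literature.MathematicalPhysics.QuantumFieldTheory.Balaban1983to89.AveragingRT
  (axialAvg line measurable_axialAvg axialAvg_mul_last measure_eq_mass_smul_of_invariant measurePreserving_mulRight measurePreserving_mulLeft)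

/-! ## §1 A measure-preserving symmetry of the density fixes the weighted measure -/
section Generic

variable {α : Type*} [MeasurableSpace α] {μ : Measure α}

/-- **A measure-preserving map that fixes the density fixes the weighted measure**: `R_* μ = μ`, `f ∘ R = f` ⇒ `R_*(f·μ) = f·μ`. [folklore] -/
theorem map_withDensity_eq_of_comp_eq {R : α → α} (hR : MeasurePreserving R μ μ) {f : α → ℝ≥0∞} (hf : Measurable f)
    (hfR : ∀ x, f (R x) = f x) : (μ.withDensity f).map R = μ.withDensity f := by
  ext A hA
  rw [Measure.map_apply hR.measurable hA, withDensity_apply _ (hR.measurable hA), withDensity_apply _ hA]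
  calc ∫⁻ x in R ⁻¹' A, f x ∂μ = ∫⁻ x in R ⁻¹' A, f (R x) ∂μ := by simp only [hfR]
    _ = ∫⁻ y in A, f y ∂(μ.map R) := (setLIntegral_map hA hf hR.measurable).symm
    _ = ∫⁻ y in A, f y ∂μ := by rw [hR.map_eq]

end Generic

/-! ## §2 The weighted push-forward under the straight transporter -/
section Axial

variable {P : Params} {j : ℕ} {G : Type*} [GaugeGroup G] [MeasurableSpace G] [HaarData G] [MeasurableMul₂ G]

/-- ★★★ **WEIGHTED LAUNDERING ALONG THE AXIAL REFERENCE.**  Let `f ≥ 0` be a measurable density on the level-`j` fields with finite integral which does NOT READ THE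
LAST BOND OF ANY STRAIGHT SEGMENT — precisely: `f` is invariant under right-multiplication of the last bond of every segment `c` by `g(c)`, for every coarse field `g`.
Then the straight transporter pushes `f·dU_j` to an EXACT multiple of product Haar: `((dU_j).withDensity f).map axialAvg = (∫⁻ f dU_j) • dU_{j+1}` (standing range).
Proof: the push-forward is a finite measure invariant under all right translations of the coarse field (`axialAvg_mul_last` + §1 with the measure-preserving
right-multiplication of the last bonds) and `dU_{j+1}` is a left-invariant probability; Weil's uniqueness `measure_eq_mass_smul_of_invariant`.
[cite: Balaban1987RG1, (0.4) p.253 (the straight transporter); Balaban1985Averaging, (10) p.19 (bookkeeping)] -/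
theorem map_withDensity_axialAvg_eq_smul (hj : j + 1 ≤ P.m + P.K) {f : GaugeField P j G → ℝ≥0∞} (hf : Measurable f)
    (hfin : ∫⁻ U, f U ∂(fieldMeasure P j G) ≠ ∞)
    (hlast : ∀ (g : GaugeField P (j + 1) G) (U : GaugeField P j G),
      f (fun b => U b * Function.extend (fun c : PBond P (j + 1) => line c (P.L - 1)) g (fun _ => 1) b) = f U) :
    ((fieldMeasure P j G).withDensity f).map (axialAvg : GaugeField P j G → GaugeField P (j + 1) G) =
      (∫⁻ U, f U ∂(fieldMeasure P j G)) • fieldMeasure P (j + 1) G := by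
  letI : Group (GaugeField P (j + 1) G) := Pi.group
  letI : MeasurableMul₂ (GaugeField P (j + 1) G) := Pi.measurableMul₂
  have hmeas : Measurable (axialAvg : GaugeField P j G → GaugeField P (j + 1) G) := measurable_axialAvg
  haveI : IsFiniteMeasure ((fieldMeasure P j G).withDensity f) := isFiniteMeasure_withDensity hfin
  haveI : IsFiniteMeasure (((fieldMeasure P j G).withDensity f).map (axialAvg : GaugeField P j G → GaugeField P (j + 1) G)) :=
    Measure.isFiniteMeasure_map _ _
  have h := measure_eq_mass_smul_of_invariant (fieldMeasure P (j + 1) G)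
    (((fieldMeasure P j G).withDensity f).map (axialAvg : GaugeField P j G → GaugeField P (j + 1) G)) ?_ ?_
  · rw [h, Measure.map_apply hmeas MeasurableSet.univ, Set.preimage_univ, withDensity_apply _ MeasurableSet.univ,
      Measure.restrict_univ]
  · intro g
    exact (measurePreserving_mulLeft (P := P) (j := j + 1) g).map_eq
  · intro g
    set R : GaugeField P j G → GaugeField P j G := fun U b =>
      U b * Function.extend (fun c : PBond P (j + 1) => line c (P.L - 1)) g (fun _ => 1) b with hR
    have hRmp : MeasurePreserving R (fieldMeasure P j G) (fieldMeasure P j G) := measurePreserving_mulRight _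
    have hRf : ((fieldMeasure P j G).withDensity f).map R = (fieldMeasure P j G).withDensity f :=
      map_withDensity_eq_of_comp_eq hRmp hf (fun U => hlast g U)
    have hcomp : ((fun x => x * g) ∘ (axialAvg : GaugeField P j G → GaugeField P (j + 1) G)) = axialAvg ∘ R := by
      funext U
      show (fun c => axialAvg U c * g c) = axialAvg (R U)
      rw [hR, axialAvg_mul_last hj]
    calc (((fieldMeasure P j G).withDensity f).map axialAvg).map (fun x => x * g)
        = ((fieldMeasure P j G).withDensity f).map ((fun x => x * g) ∘ axialAvg) := Measure.map_map (measurable_mul_const g) hmeas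
      _ = ((fieldMeasure P j G).withDensity f).map (axialAvg ∘ R) := by rw [hcomp]
      _ = (((fieldMeasure P j G).withDensity f).map R).map axialAvg := (Measure.map_map hmeas hRmp.measurable).symm
      _ = ((fieldMeasure P j G).withDensity f).map axialAvg := by rw [hRf]

/-- ★ **SET FORM**: for a measurable set `A` of fine fields invariant under right-translation of the last bonds, `(dU_j↾A)∘Ū_ax⁻¹ = dU_j(A) • dU_{j+1}` — conditioning the
axial reference on an event that no last bond sees changes its image law only by the total mass (the many-bond twin of `AveragingRT.restrict_map_axialAvg`). [folklore] -/
theorem map_restrict_axialAvg_eq_smul (hj : j + 1 ≤ P.m + P.K) {A : Set (GaugeField P j G)} (hA : MeasurableSet A)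
    (hlast : ∀ (g : GaugeField P (j + 1) G) (U : GaugeField P j G),
      (fun b => U b * Function.extend (fun c : PBond P (j + 1) => line c (P.L - 1)) g (fun _ => 1) b) ∈ A ↔ U ∈ A) :
    ((fieldMeasure P j G).restrict A).map (axialAvg : GaugeField P j G → GaugeField P (j + 1) G) =
      (fieldMeasure P j G A) • fieldMeasure P (j + 1) G := by
  classical
  have hfin : ∫⁻ U, A.indicator (1 : GaugeField P j G → ℝ≥0∞) U ∂(fieldMeasure P j G) ≠ ∞ := by
    rw [lintegral_indicator_one hA]; exact measure_ne_top _ _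
  have hinv : ∀ (g : GaugeField P (j + 1) G) (U : GaugeField P j G),
      A.indicator (1 : GaugeField P j G → ℝ≥0∞)
          (fun b => U b * Function.extend (fun c : PBond P (j + 1) => line c (P.L - 1)) g (fun _ => 1) b) =
        A.indicator (1 : GaugeField P j G → ℝ≥0∞) U := by
    intro g U
    set R : GaugeField P j G → GaugeField P j G := fun V b =>
      V b * Function.extend (fun c : PBond P (j + 1) => line c (P.L - 1)) g (fun _ => 1) b with hR
    have hpre : R ⁻¹' A = A := Set.ext fun V => hlast g V
    show A.indicator 1 (R U) = A.indicator 1 U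
    rw [← Set.indicator_comp_right, hpre]
    rfl
  rw [← withDensity_indicator_one hA, map_withDensity_axialAvg_eq_smul hj (measurable_one.indicator hA) hfin hinv,
    lintegral_indicator_one hA]

end Axial

end Summit.QuantumFields.YangMills.Theorems.BalabanUVNodesN08AxialLaunderingWeighted

end
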